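import Literature.NumberTheory.GaloisRepresentations.LocalWeilDatum
import Literature.NumberTheory.GaloisRepresentations.AbsGaloisGroupOpenNormal
import Literature.NumberTheory.GaloisRepresentations.GaloisCohomology
import Mathlib.FieldTheory.Galois.GaloisClosure
import HarnessLib

/-!
# The closed subgroups `Gal(K̄/E) ≤ Γ_k` of the absolute Galois group (Serre II §1, Neukirch IV §1)

For a field `k` with algebraic closure `K̄ = AlgebraicClosure k` and absolute Galois group
`Γ_k = Field.absoluteGaloisGroup k = Aut_k(K̄)` (Krull topology), every subextension
`E ⊆ K̄` of `k` has its fixing subgroup `Gal(K̄/E) ≤ Γ_k`, the tree's `LocalWeilDatum.galFixing k E`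
(`LocalWeilDatum.lean`, with `mem_galFixing_iff`, `galFixing_antitone`, `galFixing_sup`,
`isOpen_galFixing`, `isClosed_galFixing`).  This file adds to that dictionary what the
cohomological arguments towards
`Literature.NumberTheory.GaloisRepresentations.tsen_fieldCdLE_one_of_trdeg_eq_one` use:

* bridges `galFixing k E = absGaloisFixingSubgroup E = ker (resGal E)` for `E/k` normal (so the
  three spellings in the tree are connected), and normality;
* `exists_finiteDimensional_isGalois_galFixing_subset` — every neighbourhood of `1` in `Γ_k`
  contains `Gal(K̄/E)` for a **finite Galois** `E/k` (no separability hypothesis on `k`: shrink a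
  finite normal `E₀` given by the Krull topology to the separable closure of `k` in `E₀`, which has
  the same fixing subgroup);
* for a finite Galois `L/k` inside `K̄`, a name `resGal L : Γ_k → Gal(L/k)` for the restriction,
  surjective with kernel `galFixing k L`, and the transport of the finite Galois correspondence:
  `galFixing k (lift E') = Gal(L/E')⁻¹`, `galFixing k (lift (fixedField H)) = H⁻¹` (preimages
  under `resGal L`), with the index and relative-index consequences.

## References

* J.-P. Serre, *Cohomologie galoisienne* (1994/1997), II §1.1. [SerreGaloisCohomology1997]
* J. Neukirch, *Algebraic Number Theory* (1999), Ch. IV §1. [NeukirchANT1999]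
-/

noncomputable section

open Topology Filter IntermediateField Field

universe u

namespace Literature.NumberTheory.GaloisRepresentations

open LocalWeilDatum

variable {k : Type u} [Field k]

/-! ### The fixing subgroups -/

/-- The identification `Γ_k = Aut_k(K̄)` (`absoluteGaloisGroup.toAlgEquiv`, the identity) is
continuous: the topology of `Γ_k` is the Krull topology by definition. [folklore] -/
theorem continuous_toAlgEquiv :
    Continuous (absoluteGaloisGroup.toAlgEquiv k :
      absoluteGaloisGroup k → (AlgebraicClosure k ≃ₐ[k] AlgebraicClosure k)) :=
  continuous_id

/-- The inverse identification is continuous. [folklore] -/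
theorem continuous_toAlgEquiv_symm :
    Continuous ((absoluteGaloisGroup.toAlgEquiv k).symm :
      (AlgebraicClosure k ≃ₐ[k] AlgebraicClosure k) → absoluteGaloisGroup k) :=
  continuous_id

/-- For a normal subextension, `galFixing k E` is the tree's `absGaloisFixingSubgroup E` (the
kernel of the restriction to `E`, `GaloisCohomology.lean`). [folklore] -/
theorem galFixing_eq_absGaloisFixingSubgroup (E : IntermediateField k (AlgebraicClosure k))
    [Normal k E] :
    galFixing k E = absGaloisFixingSubgroup E :=
  Subgroup.ext fun σ => (mem_galFixing_iff k).trans (mem_absGaloisFixingSubgroup_iff E σ).symm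

/-- `Gal(K̄/E) ⊴ Γ_k` for `E/k` normal. [folklore] -/
theorem normal_galFixing (E : IntermediateField k (AlgebraicClosure k)) [Normal k E] :
    (galFixing k E).Normal := by
  rw [galFixing_eq_absGaloisFixingSubgroup]
  infer_instance

/-! ### Small open subgroups come from finite Galois extensions -/

/-- **Every neighbourhood of `1` in `Γ_k` contains `Gal(K̄/E)` for a finite Galois `E/k`.**  The
Krull topology gives a finite normal `E₀/k` (`krullTopology_mem_nhds_one_iff_of_normal`); the
separable closure `E` of `k` in `E₀` is finite Galois, and an automorphism fixing `E` fixes `E₀`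
(`apply_eq_self_of_forall_mem_separableClosure`), so `Gal(K̄/E) = Gal(K̄/E₀)`.
[cite: SerreGaloisCohomology1997, II §1.1] [cite: NeukirchANT1999, Ch. IV §1] -/
theorem exists_finiteDimensional_isGalois_galFixing_subset {U : Set (absoluteGaloisGroup k)}
    (hU : U ∈ 𝓝 (1 : absoluteGaloisGroup k)) :
    ∃ E : IntermediateField k (AlgebraicClosure k), FiniteDimensional k E ∧ IsGalois k E ∧
      (galFixing k E : Set (absoluteGaloisGroup k)) ⊆ U := by
  -- transport to `Aut_k(K̄)` (the identity homeomorphism)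
  have hU' : (absoluteGaloisGroup.toAlgEquiv k).symm ⁻¹' U ∈
      𝓝 (1 : AlgebraicClosure k ≃ₐ[k] AlgebraicClosure k) :=
    continuous_toAlgEquiv_symm.continuousAt.preimage_mem_nhds (by rwa [map_one])
  obtain ⟨E₀, hE₀fin, hE₀normal, hE₀U⟩ :=
    (krullTopology_mem_nhds_one_iff_of_normal k (AlgebraicClosure k) _).1 hU'
  haveI := hE₀fin
  haveI := hE₀normal
  haveI : IsGalois k (separableClosure k E₀) := separableClosure.isGalois k E₀
  refine ⟨lift (separableClosure k E₀), (liftAlgEquiv _).toLinearEquiv.finiteDimensional,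
    IsGalois.of_algEquiv (liftAlgEquiv _), fun σ hσ => ?_⟩
  have hσ' : (absoluteGaloisGroup.toAlgEquiv k σ) ∈ (E₀.fixingSubgroup : Set _) := by
    rw [SetLike.mem_coe, IntermediateField.mem_fixingSubgroup_iff]
    intro x hx
    exact apply_eq_self_of_forall_mem_separableClosure E₀ _
      (fun y hy => (mem_galFixing_iff k).1 hσ y hy) x hx
  exact hE₀U hσ'

/-! ### Restriction to a finite Galois extension -/

section Finite

variable (L : IntermediateField k (AlgebraicClosure k)) [Normal k L]

/-- The restriction `Γ_k → Gal(L/k)` for a normal subextension `L ⊆ K̄`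
(Mathlib `AlgEquiv.restrictNormalHom`). [cite: NeukirchANT1999, Ch. IV §1] -/
def resGal : absoluteGaloisGroup k →* (L ≃ₐ[k] L) :=
  (AlgEquiv.restrictNormalHom (F := k) (K₁ := (AlgebraicClosure k)) L).comp
    (absoluteGaloisGroup.toAlgEquiv k).toMonoidHom

/-- `resGal L σ` is `σ` on elements of `L`. [folklore] -/
theorem coe_resGal_apply (σ : absoluteGaloisGroup k) (x : L) :
    ((resGal L σ x : L) : (AlgebraicClosure k)) = σ • (x : (AlgebraicClosure k)) :=
  AlgEquiv.restrictNormal_commutes (absoluteGaloisGroup.toAlgEquiv k σ) L x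

/-- `resGal L` is surjective (extension of automorphisms to the algebraic closure,
Mathlib `AlgEquiv.restrictNormalHom_surjective`). [cite: NeukirchANT1999, Ch. IV §1] -/
theorem resGal_surjective : Function.Surjective (resGal L) :=
  (AlgEquiv.restrictNormalHom_surjective (F := k) (AlgebraicClosure k)).comp
    (absoluteGaloisGroup.toAlgEquiv k).surjective

/-- For a subextension `E' ⊆ L`, `Gal(K̄/E')` is the preimage of `Gal(L/E')` under `resGal L`.
[cite: NeukirchANT1999, Ch. IV §1] -/
theorem galFixing_lift (E' : IntermediateField k L) :
    galFixing k (lift E') = E'.fixingSubgroup.comap (resGal L) := by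
  ext σ
  rw [mem_galFixing_iff, Subgroup.mem_comap, IntermediateField.mem_fixingSubgroup_iff]
  constructor
  · intro h x hx
    apply Subtype.ext
    rw [coe_resGal_apply]
    exact h _ ((mem_lift x).2 hx)
  · intro h y hy
    have hyL : y ∈ L := lift_le _ hy
    have hyE : (⟨y, hyL⟩ : L) ∈ E' := (mem_lift ⟨y, hyL⟩).1 hy
    have h2 := congrArg (fun z : L => (z : AlgebraicClosure k)) (h ⟨y, hyL⟩ hyE)
    dsimp only at h2
    rwa [coe_resGal_apply] at h2

/-- The kernel of `resGal L` is `Gal(K̄/L)` (cf. the tree's `galFixing_eq_ker_restrictNormalHom`,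
the same statement with the restriction spelled out). [cite: NeukirchANT1999, Ch. IV §1] -/
theorem ker_resGal : (resGal L).ker = galFixing k L := by
  have h := galFixing_lift L (⊤ : IntermediateField k L)
  rw [IntermediateField.lift_top, IntermediateField.fixingSubgroup_top] at h
  rw [h, MonoidHom.comap_bot]

/-- **Transport of the finite Galois correspondence**: for `L/k` finite Galois and
`H ≤ Gal(L/k)`, `Gal(K̄/L^H)` is the preimage of `H` under `resGal L`.
[cite: NeukirchANT1999, Ch. IV §1] -/
theorem galFixing_lift_fixedField [FiniteDimensional k L] [IsGalois k L]
    (H : Subgroup (L ≃ₐ[k] L)) : galFixing k (lift (fixedField H)) = H.comap (resGal L) := by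
  rw [galFixing_lift, IntermediateField.fixingSubgroup_fixedField]

/-- The index of `Gal(K̄/L^H)` in `Γ_k` is the index of `H` in `Gal(L/k)`. [folklore] -/
theorem index_galFixing_lift_fixedField [FiniteDimensional k L] [IsGalois k L]
    (H : Subgroup (L ≃ₐ[k] L)) : (galFixing k (lift (fixedField H))).index = H.index := by
  rw [galFixing_lift_fixedField, Subgroup.index_comap_of_surjective _ (resGal_surjective L)]

/-- Relative indices are likewise preserved. [folklore] -/
theorem relIndex_galFixing_lift_fixedField [FiniteDimensional k L] [IsGalois k L]
    (H H' : Subgroup (L ≃ₐ[k] L)) :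
    (galFixing k (lift (fixedField H))).relIndex (galFixing k (lift (fixedField H'))) =
      H.relIndex H' := by
  rw [galFixing_lift_fixedField, galFixing_lift_fixedField,
    Subgroup.relIndex_comap, Subgroup.map_comap_eq_self_of_surjective (resGal_surjective L)]

omit [Normal k L] in
/-- `lift E' ≤ L`, whence `galFixing k L ≤ galFixing k (lift E')`. [folklore] -/
theorem galFixing_le_galFixing_lift (E' : IntermediateField k L) :
    galFixing k L ≤ galFixing k (lift E') :=
  galFixing_antitone k (lift_le _)

end Finite

end Literature.NumberTheory.GaloisRepresentations

end
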